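import Mathlib.NumberTheory.DirichletCharacter.Orthogonality
import Mathlib.RingTheory.RootsOfUnity.AlgebraicallyClosed
import Mathlib.Analysis.Complex.Polynomial.Basic
import Mathlib.Analysis.SpecialFunctions.Complex.Circle
import Mathlib.Data.Nat.Totient
import HarnessLib

/-!
# Short character sums over `(0, N/r)` via generalized Bernoulli numbers (Szmidt–Urbanowicz–Zagier 1995)

Topic `NumberTheory/LFunctions`; namespace `Literature.NumberTheory.LFunctions`. A NAMED FACT
(`def … : Prop`, no proof claimed), vendored by a grounder of route
`Summits/QuantumAdvantage/QuantumAdvantage/Theses/ThirdFactorialPincer`, whose support item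
`NormIsRelClassNumber` (stmt-QuantumAdvantage-11649) and cruxes `IdealLegOfERH` / `ArgLeg` /
`AllGaussFactorialsMemFBQP` rest on the dictionary "`S_p := Σ_{0<j<p/3} χ_p(j) = −χ̄_p(3) B_{1,χ_pψ₃}/2`"
between the short cubic character sum and a generalized Bernoulli number — the case `m = 1`,
`r = 3`, `N = M = p` of the identity below.

## Source (read on the held text `paper:doi-10-4064-aa-71-3-273-278`, journal page numbers)

J. Szmidt, J. Urbanowicz, D. Zagier, *Congruences among generalized Bernoulli numbers*, Acta
Arith. **71** (1995) 273–278 [SzmidtUrbanowiczZagier1995]. Part 2 of the proof of the Theorem,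
p. 275: "Now let `N` be a multiple of `M` and `r` an integer prime to `N`." and p. 276, identity (6):

  `m r^{m-1} Σ_{0<n<N/r} χ(n) n^{m-1} = −B_{m,χ} r^{m-1} + (χ̄(r)/φ(r)) Σ_ψ ψ̄(−N) B_{m,χψ}(N)`,

"where the sum is over all Dirichlet characters `ψ` modulo `r`" (p. 275), `χ` a Dirichlet character
modulo `M`, `B_{m,χ}` the generalized Bernoulli numbers of (1)/(5) and
`B_{m,χ}(X) = Σ_n C(m,n) B_{n,χ} X^{m-n}` the generalized Bernoulli polynomial (p. 274), `χψ` being a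
character modulo `Mr`. The same page gives (from (4)–(5)) the recursion
`m Σ_{n=1}^{M} χ(n) n^{m-1} = Σ_{k=1}^{m} C(m,k) B_{m-k,χ} M^k` (p. 274, last display), whence for a
NON-TRIVIAL character `θ` modulo `L`: `B_{0,θ} = (1/L) Σ_{n=1}^{L} θ(n) = 0` and
`B_{1,θ} = (1/L) Σ_{n=1}^{L} θ(n) n`.

## What is vendored (the case `m = 1`, written out with these two evaluations)

For `χ ≠ 1` modulo `M`, `M ∣ N`, `gcd(r, N) = 1`, every `χψ` (`ψ` mod `r`) is a non-trivial
character modulo `Mr` (as `gcd(M, r) = 1`), so `B_{1,χψ}(N) = B_{1,χψ} + N·B_{0,χψ} = B_{1,χψ}` and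
(6) at `m = 1` reads

  `Σ_{0<n<N/r} χ(n) = −(1/M) Σ_{n=1}^{M} χ(n) n + (χ(r)⁻¹/φ(r)) Σ_{ψ mod r} ψ(−N)⁻¹ (1/(Mr)) Σ_{a=1}^{Mr} χ(a) ψ(a) a` —

the statement `szmidtUrbanowiczZagier_shortSum` below (fact = print ∘ specialisation `m = 1` ∘ the
printed evaluations of `B_{0,θ}`, `B_{1,θ}`; `χ̄(r) = χ(r)⁻¹`, `ψ̄(−N) = ψ(−N)⁻¹` on units). In the
route: `M = N = p`, `r = 3`, `χ = χ_p` cubic (even, so the first term vanishes, as does the `ψ = 1`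
term), leaving `S_p = −χ_p(3)⁻¹ B_{1,χ_pψ₃}/2` with `ψ₃ = (·/3)`, `ψ₃(−p) = −1`. Not in Mathlib
(which has `bernoulli`, `Polynomial.bernoulli`, `DirichletCharacter`, but no generalized Bernoulli
numbers; the tree's `BernoulliOneOdd.lean` inlines `B_{1,χ}` for prime modulus only).

## References

* [SzmidtUrbanowiczZagier1995] Acta Arith. 71 (1995), pp. 274–276, identities (4)–(6).
* L. C. Washington, *Introduction to Cyclotomic Fields*, 2nd ed. (1997), Ch. 4 (generalized
  Bernoulli numbers; Thm 4.17 relative class number formula) — context only.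
-/

noncomputable section

open Finset

namespace Literature.NumberTheory.LFunctions

/-- **Szmidt–Urbanowicz–Zagier 1995, identity (6) at `m = 1` (short character sum over
`(0, N/r)`).** For a non-trivial Dirichlet character `χ` modulo `M ≥ 1`, a multiple `N` of `M` and
`r ≥ 1` prime to `N`:
`Σ_{0<n<N/r} χ(n) = −(1/M)Σ_{n=1}^{M} χ(n)·n + (χ(r)⁻¹/φ(r)) Σ_{ψ mod r} ψ(−N)⁻¹·(1/(Mr))Σ_{a=1}^{Mr} (χψ)(a)·a`,
where `χψ` is the product character modulo `Mr` and the `ψ`-sum runs over all Dirichlet characters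
modulo `r` (printed for all `m ≥ 1` with generalized Bernoulli numbers `B_{m,χ}`, `B_{m,χψ}(N)`; here
`B_{0,θ} = 0`, `B_{1,θ} = (1/L)Σ_{n≤L} θ(n) n` for non-trivial `θ` mod `L`, p. 274, are substituted).
The summation range `0 < n < N/r` is `{n ∈ [1, N] : r·n < N}`. Grounds the `S_p`/Bernoulli dictionary of
`Summit.QuantumAdvantage.QuantumAdvantage.Theses.ThirdFactorialPincer.NormIsRelClassNumber` (and
`IdealLegOfERH`, `ArgLeg`). [cite: SzmidtUrbanowiczZagier1995, identity (6) p. 276 (m = 1) with p. 274] -/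
def szmidtUrbanowiczZagier_shortSum : Prop :=
  ∀ (M r N : ℕ) [NeZero M] [NeZero r] (χ : DirichletCharacter ℂ M), χ ≠ 1 → M ∣ N →
    Nat.Coprime r N →
      (∑ n ∈ (Finset.Icc 1 N).filter (fun n => r * n < N), χ (n : ZMod M)) =
        -((1 : ℂ) / M) * (∑ n ∈ Finset.Icc 1 M, χ (n : ZMod M) * (n : ℂ)) +
          (χ (r : ZMod M))⁻¹ / (Nat.totient r : ℂ) *
            ∑ ψ : DirichletCharacter ℂ r,
              (ψ (-(N : ZMod r)))⁻¹ *
                ((1 : ℂ) / ((M * r : ℕ) : ℂ) *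
                  ∑ a ∈ Finset.Icc 1 (M * r),
                    (DirichletCharacter.changeLevel (dvd_mul_right M r) χ *
                        DirichletCharacter.changeLevel (dvd_mul_left r M) ψ) (a : ZMod (M * r)) *
                      (a : ℂ))

end Literature.NumberTheory.LFunctions

/-! ## Proof of the identity (discharge of `szmidtUrbanowiczZagier_shortSum`)

We follow Part 2 of the proof of the Theorem in [SzmidtUrbanowiczZagier1995, pp. 275–276] at
`m = 1`, working with the finite sums themselves instead of the generating series
`L_χ(t) = Σ_{n ≥ 1} χ(n) e^{nt}`; the three ingredients are the paper's, in the same order: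

* orthogonality of the `φ(r)` characters `ψ` modulo `r` against the unit `−N`
  (`Σ_ψ ψ̄(−N) ψ(a) = φ(r)·[a ≡ −N (mod r)]`, Mathlib's `sum_char_inv_mul_char_eq`), together with
  `(χψ)(a) = χ(a) ψ(a)` for the product character modulo `Mr` (`gcd(M, r) = 1`), collapses
  `Σ_ψ ψ̄(−N) · (1/(Mr)) Σ_{a ≤ Mr} (χψ)(a) a` to `(φ(r)/(Mr)) Σ_{a ≤ Mr, a ≡ −N (r)} χ(a) a`;
* the paper's substitution "`r ∣ n + N`, `n ↦ (n + N)/r`", i.e. `a = r b − N` with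
  `N/r < b ≤ N/r + M`, turns this into `(φ(r)/(Mr)) Σ_b χ(r) χ(b) (r b − N)` (as `M ∣ N`,
  `χ(r b − N) = χ(r) χ(b)`);
* the evaluation of character sums over `M` consecutive integers — the cases `m = 1, 2` of the
  recursion below (5), p. 274 (`B_{0,χ} = (1/M) Σ_{n ≤ M} χ(n) = 0`,
  `B_{1,χ} = (1/M) Σ_{n ≤ M} χ(n) n` for `χ ≠ 1`), in shifted finite form:
  `Σ_{i<M} χ(B+i) = 0` and `Σ_{i<M} χ(B+1+i)(B+1+i) = Σ_{i<M} χ(1+i)(1+i) + M Σ_{1 ≤ n ≤ B} χ(n)`.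

Finally `Σ_{0<n<N/r} χ(n) = Σ_{1 ≤ n ≤ ⌊N/r⌋} χ(n)` because `r ∤ N` unless `r = 1`, where the extra
term is `χ(N) = 0`.
-/

namespace Literature.NumberTheory.LFunctions

namespace SzmidtUrbanowiczZagier

/-- A sum over `0 ≤ i < M` of a function of the residue of `i` mod `M` is the sum over `ZMod M`.
[folklore] -/
theorem sum_range_natCast_eq_sum_univ {M : ℕ} [NeZero M] {A : Type*} [AddCommMonoid A]
    (f : ZMod M → A) : ∑ i ∈ range M, f (i : ZMod M) = ∑ x : ZMod M, f x := by
  refine Finset.sum_nbij' (fun b : ℕ => (b : ZMod M)) (fun j => j.val) (by simp)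
    (fun j _ => mem_range.2 (ZMod.val_lt j)) (fun b hb => ?_) (fun j _ => ?_) (fun _ _ => rfl)
  · exact ZMod.val_cast_of_lt (mem_range.1 hb)
  · exact ZMod.natCast_zmod_val j

/-- Periodicity of a Dirichlet character modulo `M` along the naturals: `χ(B + M) = χ(B)`.
[folklore] -/
theorem apply_natCast_add_modulus {M : ℕ} (χ : DirichletCharacter ℂ M) (B : ℕ) :
    χ ((B + M : ℕ) : ZMod M) = χ (B : ZMod M) := by
  rw [Nat.cast_add, ZMod.natCast_self, add_zero]

/-- Shifting a window of `M` consecutive arguments by one step: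
`Σ_{i<M} F(B+1+i) = Σ_{i<M} F(B+i) + F(B+M) − F(B)`. [folklore] -/
theorem sum_range_apply_add_succ {M : ℕ} (F : ℕ → ℂ) (B : ℕ) :
    ∑ i ∈ range M, F (B + 1 + i) = ∑ i ∈ range M, F (B + i) + F (B + M) - F B := by
  have h1 : ∑ i ∈ range (M + 1), F (B + i) = ∑ i ∈ range M, F (B + 1 + i) + F B := by
    rw [Finset.sum_range_succ', Nat.add_zero]
    congr 1
    exact Finset.sum_congr rfl fun i _ => by congr 1; omega
  rw [eq_sub_iff_add_eq, ← h1, Finset.sum_range_succ]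

/-- A non-trivial character modulo `M` sums to zero over any `M` consecutive integers
(`B_{0,χ} = (1/M) Σ_{n ≤ M} χ(n) = 0`, the case `m = 1` of the recursion below (5), p. 274).
[folklore] -/
theorem sum_range_apply_add_eq_zero {M : ℕ} [NeZero M] {χ : DirichletCharacter ℂ M}
    (hχ : χ ≠ 1) : ∀ B : ℕ, ∑ i ∈ range M, χ ((B + i : ℕ) : ZMod M) = 0
  | 0 => by
    simp_rw [Nat.zero_add]
    exact (sum_range_natCast_eq_sum_univ fun x => χ x).trans (MulChar.sum_eq_zero_of_ne_one hχ)
  | B + 1 => by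
    rw [sum_range_apply_add_succ (fun n => χ (n : ZMod M)) B, sum_range_apply_add_eq_zero hχ B,
      apply_natCast_add_modulus, zero_add, sub_self]

/-- First moment of a character over a shifted window of length `M` (shifting the window in
`B_{1,χ} = (1/M) Σ_{n ≤ M} χ(n) n`, the case `m = 2` of the recursion below (5), p. 274):
`Σ_{i<M} χ(B+1+i)·(B+1+i) = Σ_{i<M} χ(1+i)·(1+i) + M · Σ_{1 ≤ n ≤ B} χ(n)` (any `χ`). [folklore] -/
theorem sum_range_apply_mul_eq {M : ℕ} (χ : DirichletCharacter ℂ M) :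
    ∀ B : ℕ, ∑ i ∈ range M, χ ((B + 1 + i : ℕ) : ZMod M) * ((B + 1 + i : ℕ) : ℂ) =
      ∑ i ∈ range M, χ ((1 + i : ℕ) : ZMod M) * ((1 + i : ℕ) : ℂ) +
        (M : ℂ) * ∑ n ∈ Icc 1 B, χ (n : ZMod M)
  | 0 => by
    rw [Finset.Icc_eq_empty (by omega), Finset.sum_empty, mul_zero, add_zero]
  | B + 1 => by
    rw [sum_range_apply_add_succ (fun n => χ (n : ZMod M) * (n : ℂ)) (B + 1),
      sum_range_apply_mul_eq χ B, Finset.sum_Icc_succ_top (Nat.le_add_left 1 B),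
      apply_natCast_add_modulus]
    push_cast
    ring

/-- For a unit `u` modulo `r`, `ψ(u)⁻¹ = ψ(u⁻¹)`. [folklore] -/
theorem inv_apply_of_isUnit {r : ℕ} (ψ : DirichletCharacter ℂ r) {u : ZMod r} (hu : IsUnit u) :
    (ψ u)⁻¹ = ψ u⁻¹ :=
  inv_eq_of_mul_eq_one_right <| by rw [← map_mul, ZMod.mul_inv_of_unit u hu, map_one]

/-- Orthogonality of the Dirichlet characters modulo `r` against the unit `−N` (`gcd(r, N) = 1`):
`Σ_ψ ψ(−N)⁻¹ ψ(a) = φ(r) · [a = −N in ZMod r]` (Mathlib's `sum_char_inv_mul_char_eq`; "the sum is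
over all Dirichlet characters `ψ` modulo `r`", p. 275). [folklore] -/
theorem sum_inv_apply_neg_mul_apply {r : ℕ} [NeZero r] {N : ℕ} (hrN : Nat.Coprime r N)
    (a : ZMod r) :
    ∑ ψ : DirichletCharacter ℂ r, (ψ (-(N : ZMod r)))⁻¹ * ψ a =
      if -(N : ZMod r) = a then (r.totient : ℂ) else 0 := by
  have hu : IsUnit (-(N : ZMod r)) := ((ZMod.isUnit_iff_coprime N r).mpr hrN.symm).neg
  simp_rw [inv_apply_of_isUnit _ hu]
  exact DirichletCharacter.sum_char_inv_mul_char_eq ℂ hu a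

/-- The product at level `M r` of the lifts of `χ` (mod `M`) and `ψ` (mod `r`) is `a ↦ χ(a) ψ(a)`
on the naturals ("`χψ` being a character modulo `Mr`", p. 275; both sides vanish unless
`gcd(a, Mr) = 1`, so no coprimality of `M`, `r` is needed for this pointwise identity).
[folklore] -/
theorem changeLevel_mul_changeLevel_apply {M r : ℕ}
    (χ : DirichletCharacter ℂ M) (ψ : DirichletCharacter ℂ r) (a : ℕ) :
    (DirichletCharacter.changeLevel (dvd_mul_right M r) χ *
        DirichletCharacter.changeLevel (dvd_mul_left r M) ψ) (a : ZMod (M * r)) =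
      χ (a : ZMod M) * ψ (a : ZMod r) := by
  rw [MulChar.mul_apply]
  by_cases ha : Nat.Coprime a (M * r)
  · have h1 := DirichletCharacter.changeLevel_eq_cast_of_dvd χ (dvd_mul_right M r)
      (ZMod.unitOfCoprime a ha)
    have h2 := DirichletCharacter.changeLevel_eq_cast_of_dvd ψ (dvd_mul_left r M)
      (ZMod.unitOfCoprime a ha)
    simp only [ZMod.coe_unitOfCoprime, dvd_mul_right, dvd_mul_left, ZMod.cast_natCast] at h1 h2
    rw [h1, h2]
  · have hl : ¬IsUnit (a : ZMod (M * r)) := fun h =>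
      ha ((ZMod.isUnit_iff_coprime a (M * r)).mp h)
    rw [MulChar.map_nonunit (DirichletCharacter.changeLevel (dvd_mul_right M r) χ) hl, zero_mul]
    by_cases haM : Nat.Coprime a M
    · have har : ¬Nat.Coprime a r := fun h => ha (Nat.Coprime.mul_right haM h)
      rw [MulChar.map_nonunit ψ (fun h => har ((ZMod.isUnit_iff_coprime a r).mp h)), mul_zero]
    · rw [MulChar.map_nonunit χ (fun h => haM ((ZMod.isUnit_iff_coprime a M).mp h)), zero_mul]

end SzmidtUrbanowiczZagier

open SzmidtUrbanowiczZagier in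
/-- **Szmidt–Urbanowicz–Zagier 1995, identity (6) at `m = 1` — proved.** Discharge of the named
fact `szmidtUrbanowiczZagier_shortSum`: for a non-trivial Dirichlet character `χ` modulo `M`,
`M ∣ N`, `gcd(r, N) = 1`,
`Σ_{0<n<N/r} χ(n) = −(1/M) Σ_{n≤M} χ(n) n`
`  + (χ(r)⁻¹/φ(r)) Σ_{ψ mod r} ψ(−N)⁻¹ (1/(Mr)) Σ_{a≤Mr} (χψ)(a) a`.
The proof is Part 2 of the paper's proof (orthogonality in `ψ`, the substitution `a = r b − N`)
carried out on finite sums, closed by the elementary evaluation of `χ`-sums over `M` consecutive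
integers (see the section docstring above).
[cite: SzmidtUrbanowiczZagier1995, identity (6) p. 276 (m = 1), proof Part 2 pp. 275–276] -/
theorem szmidtUrbanowiczZagier_shortSum_holds : szmidtUrbanowiczZagier_shortSum := by
  intro M r N _ _ χ hχ hMN hrN
  -- preliminaries
  have hr0 : 0 < r := Nat.pos_of_ne_zero (NeZero.ne r)
  have hM1 : M ≠ 1 := fun h => hχ (DirichletCharacter.level_one' χ h)
  have hrM : Nat.Coprime r M := Nat.Coprime.coprime_dvd_right hMN hrN
  have hN0 : ((N : ℕ) : ZMod M) = 0 := (ZMod.natCast_eq_zero_iff N M).mpr hMN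
  have hχN : χ (N : ZMod M) = 0 := by
    rw [hN0]
    exact DirichletCharacter.map_zero' χ hM1
  have hχr : χ (r : ZMod M) ≠ 0 := by
    have hu : IsUnit (r : ZMod M) := (ZMod.isUnit_iff_coprime r M).mpr hrM
    have h1 : χ (r : ZMod M) * χ (r : ZMod M)⁻¹ = 1 := by
      rw [← map_mul, ZMod.mul_inv_of_unit _ hu, map_one]
    exact left_ne_zero_of_mul_eq_one h1
  have hrq : r * (N / r) ≤ N := Nat.mul_div_le N r
  have hNlt : N < r * (N / r) + r := by
    have h1 := Nat.div_add_mod N r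
    have h2 := Nat.mod_lt N hr0
    omega
  -- sums over the window `B < b ≤ B + M` as `range` sums
  have hIcc : ∀ (F : ℕ → ℂ) (B : ℕ),
      ∑ b ∈ Icc (B + 1) (B + M), F b = ∑ i ∈ range M, F (B + 1 + i) := by
    intro F B
    rw [← Finset.Ico_add_one_right_eq_Icc, Finset.sum_Ico_eq_sum_range]
    have : B + M + 1 - (B + 1) = M := by omega
    rw [this]
  -- Step A: the left-hand side is `Σ_{1 ≤ n ≤ N/r} χ(n)` (`r ∤ N` unless `r = 1`, and `χ(N) = 0`)
  have hA : (∑ n ∈ (Finset.Icc 1 N).filter (fun n => r * n < N), χ (n : ZMod M)) =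
      ∑ n ∈ Icc 1 (N / r), χ (n : ZMod M) := by
    apply Finset.sum_subset
    · intro n hn
      rw [Finset.mem_filter, Finset.mem_Icc] at hn
      rw [Finset.mem_Icc]
      exact ⟨hn.1.1, (Nat.le_div_iff_mul_le hr0).mpr (by rw [mul_comm]; exact hn.2.le)⟩
    · intro n hn hnS
      rw [Finset.mem_Icc] at hn
      rw [Finset.mem_filter, Finset.mem_Icc] at hnS
      have h1 : r * n ≤ N := by
        rw [mul_comm]
        exact (Nat.le_div_iff_mul_le hr0).mp hn.2
      have hnN : n ≤ N := le_trans (Nat.le_mul_of_pos_left n hr0) h1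
      have h2 : r * n = N := by
        by_contra hne
        exact hnS ⟨⟨hn.1, hnN⟩, lt_of_le_of_ne h1 hne⟩
      have hr1 : r = 1 := Nat.Coprime.eq_one_of_dvd hrN ⟨n, h2.symm⟩
      rw [hr1, one_mul] at h2
      rw [h2]
      exact hχN
  -- Step B: orthogonality in `ψ` collapses the character sum to the residues `a ≡ -N (mod r)`
  have hB : (∑ ψ : DirichletCharacter ℂ r, (ψ (-(N : ZMod r)))⁻¹ *
      ((1 : ℂ) / ((M * r : ℕ) : ℂ) * ∑ a ∈ Finset.Icc 1 (M * r),
        (DirichletCharacter.changeLevel (dvd_mul_right M r) χ *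
            DirichletCharacter.changeLevel (dvd_mul_left r M) ψ) (a : ZMod (M * r)) *
          (a : ℂ))) =
      (1 : ℂ) / ((M * r : ℕ) : ℂ) * ((r.totient : ℂ) *
        ∑ a ∈ (Icc 1 (M * r)).filter (fun a : ℕ => -(N : ZMod r) = (a : ZMod r)),
          χ (a : ZMod M) * (a : ℂ)) := by
    calc _ = ∑ ψ : DirichletCharacter ℂ r, ∑ a ∈ Icc 1 (M * r),
          (1 : ℂ) / ((M * r : ℕ) : ℂ) * ((ψ (-(N : ZMod r)))⁻¹ * ψ (a : ZMod r)) *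
            (χ (a : ZMod M) * (a : ℂ)) := by
          refine Finset.sum_congr rfl fun ψ _ => ?_
          rw [Finset.mul_sum, Finset.mul_sum]
          refine Finset.sum_congr rfl fun a _ => ?_
          rw [changeLevel_mul_changeLevel_apply]
          ring
      _ = ∑ a ∈ Icc 1 (M * r), ∑ ψ : DirichletCharacter ℂ r,
          (1 : ℂ) / ((M * r : ℕ) : ℂ) * ((ψ (-(N : ZMod r)))⁻¹ * ψ (a : ZMod r)) *
            (χ (a : ZMod M) * (a : ℂ)) := Finset.sum_comm
      _ = (1 : ℂ) / ((M * r : ℕ) : ℂ) * ∑ a ∈ Icc 1 (M * r),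
          (∑ ψ : DirichletCharacter ℂ r, (ψ (-(N : ZMod r)))⁻¹ * ψ (a : ZMod r)) *
            (χ (a : ZMod M) * (a : ℂ)) := by
          rw [Finset.mul_sum]
          refine Finset.sum_congr rfl fun a _ => ?_
          rw [Finset.sum_mul, Finset.mul_sum]
          exact Finset.sum_congr rfl fun ψ _ => by ring
      _ = (1 : ℂ) / ((M * r : ℕ) : ℂ) * ((r.totient : ℂ) *
          ∑ a ∈ (Icc 1 (M * r)).filter (fun a : ℕ => -(N : ZMod r) = (a : ZMod r)),
            χ (a : ZMod M) * (a : ℂ)) := by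
          congr 1
          simp_rw [sum_inv_apply_neg_mul_apply hrN, ite_mul, zero_mul]
          rw [← Finset.sum_filter, Finset.mul_sum]
  -- Step C: the substitution `a = r b - N`, `N/r < b ≤ N/r + M` (the paper's `n ↦ (n+N)/r`)
  have hC : (∑ a ∈ (Icc 1 (M * r)).filter (fun a : ℕ => -(N : ZMod r) = (a : ZMod r)),
      χ (a : ZMod M) * (a : ℂ)) =
      ∑ b ∈ Icc (N / r + 1) (N / r + M),
        χ (r : ZMod M) * χ (b : ZMod M) * ((r : ℂ) * (b : ℂ) - (N : ℂ)) := by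
    symm
    refine Finset.sum_nbij' (fun b : ℕ => r * b - N) (fun a : ℕ => (a + N) / r) ?_ ?_ ?_ ?_ ?_
    · intro b hb
      rw [Finset.mem_Icc] at hb
      have hb1 : r * (N / r) + r ≤ r * b := by
        have := Nat.mul_le_mul_left r hb.1
        rwa [mul_add_one] at this
      have hb2 : r * b ≤ r * (N / r) + M * r :=
        calc r * b ≤ r * (N / r + M) := Nat.mul_le_mul_left r hb.2
          _ = r * (N / r) + M * r := by ring
      have hle : N ≤ r * b := by omega
      simp only [Finset.mem_filter, Finset.mem_Icc]
      refine ⟨⟨by omega, by omega⟩, ?_⟩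
      rw [Nat.cast_sub hle, Nat.cast_mul, ZMod.natCast_self, zero_mul, zero_sub]
    · intro a ha
      simp only [Finset.mem_filter, Finset.mem_Icc] at ha
      obtain ⟨⟨ha1, ha2⟩, hcong⟩ := ha
      have hdvd : r ∣ a + N := by
        rw [← ZMod.natCast_eq_zero_iff, Nat.cast_add, ← hcong, neg_add_cancel]
      obtain ⟨c, hc⟩ := hdvd
      simp only [Finset.mem_Icc]
      rw [hc, Nat.mul_div_cancel_left c hr0]
      constructor
      · by_contra h
        have := Nat.mul_le_mul_left r (show c ≤ N / r by omega)
        omega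
      · by_contra h
        have := Nat.mul_le_mul_left r (show N / r + M + 1 ≤ c by omega)
        have h' : r * (N / r + M + 1) = r * (N / r) + M * r + r := by ring
        omega
    · intro b hb
      rw [Finset.mem_Icc] at hb
      have hb1 : r * (N / r) + r ≤ r * b := by
        have := Nat.mul_le_mul_left r hb.1
        rwa [mul_add_one] at this
      have hle : N ≤ r * b := by omega
      show (r * b - N + N) / r = b
      rw [Nat.sub_add_cancel hle, Nat.mul_div_cancel_left b hr0]
    · intro a ha
      simp only [Finset.mem_filter, Finset.mem_Icc] at ha
      have hdvd : r ∣ a + N := by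
        rw [← ZMod.natCast_eq_zero_iff, Nat.cast_add, ← ha.2, neg_add_cancel]
      show r * ((a + N) / r) - N = a
      rw [Nat.mul_div_cancel' hdvd, Nat.add_sub_cancel]
    · intro b hb
      rw [Finset.mem_Icc] at hb
      have hb1 : r * (N / r) + r ≤ r * b := by
        have := Nat.mul_le_mul_left r hb.1
        rwa [mul_add_one] at this
      have hle : N ≤ r * b := by omega
      simp only [Nat.cast_sub hle, Nat.cast_mul, hN0, sub_zero, map_mul]
  -- Step D: evaluate the `b`-sum by the window identities
  have hT1 : ∑ n ∈ Finset.Icc 1 M, χ (n : ZMod M) * (n : ℂ) =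
      ∑ i ∈ range M, χ ((1 + i : ℕ) : ZMod M) * ((1 + i : ℕ) : ℂ) := by
    have h := hIcc (fun n => χ (n : ZMod M) * (n : ℂ)) 0
    simp only [Nat.zero_add] at h
    exact h
  have hT2 : ∑ b ∈ Icc (N / r + 1) (N / r + M), χ (b : ZMod M) * (b : ℂ) =
      ∑ i ∈ range M, χ ((1 + i : ℕ) : ZMod M) * ((1 + i : ℕ) : ℂ) +
        (M : ℂ) * ∑ n ∈ Icc 1 (N / r), χ (n : ZMod M) := by
    rw [hIcc (fun n => χ (n : ZMod M) * (n : ℂ)) (N / r)]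
    exact sum_range_apply_mul_eq χ (N / r)
  have hT3 : ∑ b ∈ Icc (N / r + 1) (N / r + M), χ (b : ZMod M) = 0 := by
    rw [hIcc (fun n => χ (n : ZMod M)) (N / r)]
    exact sum_range_apply_add_eq_zero hχ (N / r + 1)
  have hD : ∑ b ∈ Icc (N / r + 1) (N / r + M),
      χ (r : ZMod M) * χ (b : ZMod M) * ((r : ℂ) * (b : ℂ) - (N : ℂ)) =
      χ (r : ZMod M) * (r : ℂ) *
        (∑ i ∈ range M, χ ((1 + i : ℕ) : ZMod M) * ((1 + i : ℕ) : ℂ) +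
          (M : ℂ) * ∑ n ∈ Icc 1 (N / r), χ (n : ZMod M)) := by
    have h : ∀ b : ℕ, χ (r : ZMod M) * χ (b : ZMod M) * ((r : ℂ) * (b : ℂ) - (N : ℂ)) =
        χ (r : ZMod M) * (r : ℂ) * (χ (b : ZMod M) * (b : ℂ)) -
          χ (r : ZMod M) * (N : ℂ) * χ (b : ZMod M) := fun b => by ring
    simp_rw [h]
    rw [Finset.sum_sub_distrib, ← Finset.mul_sum, ← Finset.mul_sum, hT2, hT3, mul_zero, sub_zero]
  -- assembly
  have hφ : (r.totient : ℂ) ≠ 0 := by exact_mod_cast (Nat.totient_pos.mpr hr0).ne'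
  have hMc : (M : ℂ) ≠ 0 := by exact_mod_cast NeZero.ne M
  have hrc : (r : ℂ) ≠ 0 := by exact_mod_cast NeZero.ne r
  rw [hA, hB, hC, hD, hT1, Nat.cast_mul]
  field_simp
  ring

end Literature.NumberTheory.LFunctions
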